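import Summits.ResolutionOfSingularities.ResolutionOfSingularities.Theorems.PurelyInseparableDim4ResConeLevelTwoSeed
import Summits.ResolutionOfSingularities.ResolutionOfSingularities.Theorems.PurelyInseparableDim4IsolatedPowerIdeal
import HarnessLib
import HarnessLib.Audit.Tags

/-!
# Purely inseparable four-folds — the LIGHT TRIPLE TAIL, part 1 (K25a): exactness of the transported contact
# form, the level-2 MINOR, and the weights of three ledger letters (K2(p) lane, slice B, A∞ assembly K25)

[OURS · counted 0 · cell `res-dim4-pi` · K2(p) lane holder res-dim4-p-12 g3's brick (K25) «A∞(T) ASSEMBLY =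
light triple tail» by signature (bus 2026-08-29 00:46Z), seat res-dim4-p-2 g4 (lineage res-dim4-p-2).]  Pure
algebra in `K[x₀, …, x₃]`; nothing here proves K2(p)/K2(5), `NoIsolatedTrap p p` or resolution of singularities
in dimension ≥ 4 / characteristic `p`.  AI kernel work, weaker than expert review.

The A∞ regime of the light slice-B stretch (`d = 3`, three stretch-born boundary letters) carries a
TRIPLE-MERGED ledger `u·G = S·(x_N x_B x_C) + T·h^d` (res-dim4-p-9 g3's K22, res-dim4-p-3 g3's K23).  The
assembly K25 runs it along the chain; this file supplies the three pieces of algebra the chain step needs.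
* §1 **`lin_exact_of_triple_ledger`** — the strict transform `T₁h` of the contact polynomial has linear part
  proportional to the new vertex form only MODULO the new letter `x_λ`; but a triple ledger at a power-cone
  state whose contact part is `lin h = κ·L + γ·x_a` with `a` a PRODUCT letter and a fourth letter `e ∉ {a, b}`
  carrying `L` forces `γ = 0` (coefficients of `x_e^d` and `x_a x_e^{d−1}` of the degree-`d` identity
  `u(0)a₀·L^d = x_a x_b x_c·(…) + T(0)·(κL + γx_a)^d`; `1 ≤ d`, `d ≠ 0` in `K`), together with `κ ≠ 0` and
  `T(0)·κ^d = u(0)·a₀`.  So exactness is RE-DERIVED at every child; no hypothesis is carried.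
* §2 **`mem_span_triple_of_minor_eq_zero`** (+ `coeff_single_of_sub_mul_linearFormSum_mem_span_X`,
  `exists_homogeneousComponent_one_eq_of_sub_mem_span_X`: linear coefficients of `S′`, `h′` read modulo `x_λ`)
  — the level-2 MINOR: if modulo `x_λ` the cofactor is
  `U·(Σ σ_i x_i)` and the contact polynomial is `κ·(Σ ℓ_i x_i)` (`κ ≠ 0`, `ℓ_f ≠ 0`), and the `(μ, f)`-minor
  vanishes (`σ_μ ℓ_f = σ_f ℓ_μ`), then `S′ ∈ (x_λ, x_ν, h′)` — the membership res-dim4-p-9 g3's K18 /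
  res-dim4-p-3 g3's K23 (iii) turn into NON-isolation (`q ≤ r_λ + r_ν + 3`).
* §3 **`pair_add_three_le_of_triple_ledger`** / **`r_eq_of_triple_ledger`** — a triple ledger contains the three
  pair ledgers `u·G ∈ (x_X x_Y, h^d)`, so isolation gives `r_X + r_Y + 3 ≤ q` for each pair
  (res-dim4-p-12 g3's K1 `IsolatedBand.not_isIsolated_monomial_mul_of_unit_mul_mem`); with the light bound
  `q ≤ r_X + r_Y + 3` all three weights are EQUAL, `q = 2w + 3`.
* §4 **`kept_of_count`** — the move list: with weights `(w, w, w, 0)` on `(λ, B, C, f)` and a new boundary of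
  total weight `≥ 2w + 1` (the child above the floor `q = 2w + 3` at shade `3`), a chart `j′ ≠ f` keeps all of
  `λ, B, C` and the free chart `j′ = f` translates at most one of them.
bears_on: LADDER-RESOLUTION:D157-DOOR2 (res-dim4-pi · K2(p) · slice B · K25a).  Supports
stmt-ResolutionOfSingularities-16155 (helper).
-/

set_option linter.dupNamespace false -- mandated namespace of this single-conjunct summit

noncomputable section

namespace Summit.ResolutionOfSingularities.ResolutionOfSingularities.Theorems.PIDim4

namespace ResCone

open MvPolynomial Finset
open Literature.AlgebraicGeometry.Resolution
open Literature.AlgebraicGeometry.Resolution.Hauser2010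

variable {K : Type} [Field K]

/-! ## 0. Four pairwise distinct letters -/

/-- Four pairwise distinct letters are all of `Fin 4`, as a `Finset`. [folklore] -/
theorem univ_eq_of_four {a b c f : Fin 4} (hab : a ≠ b) (hac : a ≠ c) (haf : a ≠ f) (hbc : b ≠ c)
    (hbf : b ≠ f) (hcf : c ≠ f) : (Finset.univ : Finset (Fin 4)) = {a, b, c, f} := by
  symm
  apply Finset.eq_univ_of_card
  rw [Finset.card_insert_of_notMem (by simp [hab, hac, haf]), Finset.card_insert_of_notMem (by simp [hbc, hbf]),
    Finset.card_insert_of_notMem (by simp [hcf]), Finset.card_singleton, Fintype.card_fin]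

/-- A sum over `Fin 4` written out on four pairwise distinct letters. [folklore] -/
theorem sum_univ_of_four {M : Type} [AddCommMonoid M] {a b c f : Fin 4} (hab : a ≠ b) (hac : a ≠ c)
    (haf : a ≠ f) (hbc : b ≠ c) (hbf : b ≠ f) (hcf : c ≠ f) (g : Fin 4 → M) :
    ∑ i, g i = g a + g b + g c + g f := by
  rw [univ_eq_of_four hab hac haf hbc hbf hcf, Finset.sum_insert (by simp [hab, hac, haf]),
    Finset.sum_insert (by simp [hbc, hbf]), Finset.sum_pair hcf]
  simp only [add_assoc]

/-! ## 1. Exactness of the contact form from a triple ledger -/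

/-- `coeff_{x_e^d} (Σ ℓ_i x_i)^d = ℓ_e^d`, read through `D_e^{(d)}`. [folklore] -/
theorem coeff_single_linearFormSum_pow (e : Fin 4) (ℓ : Fin 4 → K) (d : ℕ) :
    coeff (Finsupp.single e d) ((∑ i, C (ℓ i) * X i : MvPolynomial (Fin 4) K) ^ d) = ℓ e ^ d := by
  have h1 := IsolatedBand.coeff_hasseDeriv_single' e d ((∑ i, C (ℓ i) * X i : MvPolynomial (Fin 4) K) ^ d) 0
  rw [Finsupp.coe_zero, Pi.zero_apply, zero_add, Nat.choose_self, Nat.cast_one, one_mul, zero_add,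
    IsolatedBand.hasseDeriv_single_linearForm_pow, Nat.choose_self, Nat.cast_one, one_mul, Nat.sub_self,
    pow_zero, mul_one, coeff_C, if_pos rfl] at h1
  exact h1.symm

/-- `coeff_{x_a x_e^d} (Σ ℓ_i x_i)^{d+1} = (d + 1)·ℓ_e^d·ℓ_a` for `a ≠ e`, read through `D_e^{(d)}`. [folklore] -/
theorem coeff_single_add_single_linearFormSum_pow {a e : Fin 4} (hae : a ≠ e) (ℓ : Fin 4 → K) (d : ℕ) :
    coeff (Finsupp.single a 1 + Finsupp.single e d) ((∑ i, C (ℓ i) * X i : MvPolynomial (Fin 4) K) ^ (d + 1)) =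
      (d + 1 : K) * ℓ e ^ d * ℓ a := by
  have h1 := IsolatedBand.coeff_hasseDeriv_single' e d ((∑ i, C (ℓ i) * X i : MvPolynomial (Fin 4) K) ^ (d + 1))
    (Finsupp.single a 1)
  rw [IsolatedBand.hasseDeriv_single_linearForm_pow, Nat.choose_succ_self_right, show d + 1 - d = 1 by omega,
    pow_one, coeff_C_mul, coeff_single_linearForm, Finsupp.single_eq_of_ne hae.symm, zero_add, Nat.choose_self,
    Nat.cast_one, one_mul] at h1
  rw [← h1]
  push_cast
  ring

/-- **EXACTNESS OF THE CONTACT FORM** (K25a §1): from a triple ledger `u·G = S·(x_a x_b x_c) + T·h^d` (`h ∈ 𝔪₀`,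
`ord G ≥ d ≥ 1`, `d ≠ 0` in `K`) at a power-cone state `in_d G = a₀·L^d` (`a₀ ≠ 0`, `u(0) ≠ 0`) whose contact
polynomial has linear part `κ·L + γ·x_a` — proportional to the vertex form only modulo the PRODUCT letter `x_a`
— and a fourth letter `e ∉ {a, b}` carrying `L`: `γ = 0`, `κ ≠ 0` and `T(0)·κ^d = u(0)·a₀`. [OURS] [folklore] -/
theorem lin_exact_of_triple_ledger {a b c e : Fin 4} (hab : a ≠ b) (hea : e ≠ a) (heb : e ≠ b)
    {G h u S T : MvPolynomial (Fin 4) K} {d : ℕ} (hd : 1 ≤ d) (hdK : (d : K) ≠ 0)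
    (hG : u * G = S * (X a * X b * X c) + T * h ^ d) (hh : h ∈ originIdeal K)
    (hordG : ∀ m ∈ G.support, d ≤ m.degree) {a₀ κ γ : K} {ℓ : Fin 4 → K}
    (hcone : homogeneousComponent d G = C a₀ * (∑ i, C (ℓ i) * X i) ^ d)
    (hlin : homogeneousComponent 1 h = C κ * (∑ i, C (ℓ i) * X i) + C γ * X a) (ha₀ : a₀ ≠ 0)
    (hu : MvPolynomial.eval (0 : Fin 4 → K) u ≠ 0) (he : ℓ e ≠ 0) :
    γ = 0 ∧ κ ≠ 0 ∧ MvPolynomial.eval 0 T * κ ^ d = MvPolynomial.eval 0 u * a₀ := by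
  classical
  obtain ⟨d, rfl⟩ : ∃ d', d = d' + 1 := ⟨d - 1, by omega⟩
  rw [MvPolynomial.eval_zero] at hu
  -- the inexact contact part as ONE linear form
  set m : Fin 4 → K := fun i => κ * ℓ i + if i = a then γ else 0 with hm
  have hM : C κ * (∑ i, C (ℓ i) * X i) + C γ * X a = ∑ i, C (m i) * (X i : MvPolynomial (Fin 4) K) := by
    have h1 : ∀ i, C (m i) * (X i : MvPolynomial (Fin 4) K) =
        C κ * (C (ℓ i) * X i) + (if i = a then C γ * X i else 0) := by
      intro i
      simp only [hm]
      split_ifs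
      · rw [C_add, C_mul]; ring
      · rw [add_zero, C_mul]; ring
    simp_rw [h1]
    rw [Finset.sum_add_distrib, ← Finset.mul_sum, Finset.sum_ite_eq' Finset.univ a, if_pos (Finset.mem_univ a)]
  have hma : m a = κ * ℓ a + γ := by simp [hm]
  have hme : m e = κ * ℓ e := by simp [hm, hea]
  -- orders
  have hh0 : constantCoeff h = 0 := (NarrowApolarity.mem_originIdeal_iff h).mp hh
  have hoG : ((d + 1 : ℕ) : ℕ∞) ≤ ordZero G := natCast_le_ordZero_of_forall_le_degree hordG
  have hohd : ((d + 1 : ℕ) : ℕ∞) ≤ ordZero (h ^ (d + 1)) := le_ordZero_pow_of_constantCoeff_eq_zero hh0 (d + 1)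
  have hoh : ((1 : ℕ) : ℕ∞) ≤ ordZero h := by rw [Nat.cast_one, one_le_ordZero_iff]; exact hh0
  have h0u : ((0 : ℕ) : ℕ∞) ≤ ordZero u := by simp
  have h0T : ((0 : ℕ) : ℕ∞) ≤ ordZero T := by simp
  -- degree-`(d+1)` components of the ledger identity
  have huG := homogeneousComponent_mul_of_le_ordZero h0u hoG
  have hTh := homogeneousComponent_mul_of_le_ordZero h0T hohd
  have hpow := homogeneousComponent_pow_of_le_ordZero hoh (d + 1)
  rw [zero_add] at huG hTh
  rw [mul_one] at hpow
  have hcomp : C (constantCoeff u) * (C a₀ * (∑ i, C (ℓ i) * X i) ^ (d + 1)) =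
      homogeneousComponent (d + 1) (S * (X a * X b * X c)) +
        C (constantCoeff T) * (∑ i, C (m i) * X i) ^ (d + 1) := by
    have h1 := congrArg (homogeneousComponent (d + 1)) hG
    rw [map_add, huG, hTh, hpow, hcone, hlin, hM, homogeneousComponent_zero, homogeneousComponent_zero] at h1
    simpa only [← constantCoeff_eq] using h1
  -- `x_b`-free coefficients see nothing of `S · x_a x_b x_c`
  have hfree : ∀ n : Fin 4 →₀ ℕ, n b = 0 → coeff n (homogeneousComponent (d + 1) (S * (X a * X b * X c))) = 0 := by
    intro n hnb
    rw [coeff_homogeneousComponent]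
    split_ifs
    · rw [show S * (X a * X b * X c) = S * (X a * X c) * X b by ring, coeff_mul_X', if_neg]
      rw [Finsupp.mem_support_iff, not_not]
      exact hnb
    · rfl
  have hcoef : ∀ n : Fin 4 →₀ ℕ, n b = 0 →
      constantCoeff u * (a₀ * coeff n ((∑ i, C (ℓ i) * X i : MvPolynomial (Fin 4) K) ^ (d + 1))) =
        constantCoeff T * coeff n ((∑ i, C (m i) * X i : MvPolynomial (Fin 4) K) ^ (d + 1)) := by
    intro n hnb
    have h1 := congrArg (coeff n) hcomp
    rwa [coeff_C_mul, coeff_C_mul, coeff_add, hfree n hnb, zero_add, coeff_C_mul] at h1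
  -- Step 1: the coefficient of `x_e^{d+1}`
  have hE1 : constantCoeff u * a₀ = constantCoeff T * κ ^ (d + 1) := by
    have h1 := hcoef (Finsupp.single e (d + 1)) (by rw [Finsupp.single_eq_of_ne heb.symm])
    rw [coeff_single_linearFormSum_pow, coeff_single_linearFormSum_pow, hme, mul_pow, ← mul_assoc,
      ← mul_assoc] at h1
    exact mul_right_cancel₀ (pow_ne_zero _ he) h1
  have hκ : κ ≠ 0 := by
    rintro rfl
    rw [zero_pow (Nat.succ_ne_zero d), mul_zero] at hE1
    exact mul_ne_zero hu ha₀ hE1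
  have hT : constantCoeff T ≠ 0 := by
    intro h0
    rw [h0, zero_mul] at hE1
    exact mul_ne_zero hu ha₀ hE1
  -- Step 2: the coefficient of `x_a x_e^d`
  have hE2 := hcoef (Finsupp.single a 1 + Finsupp.single e d) (by
    rw [Finsupp.add_apply, Finsupp.single_eq_of_ne hab.symm, Finsupp.single_eq_of_ne heb.symm, add_zero])
  rw [coeff_single_add_single_linearFormSum_pow (Ne.symm hea), coeff_single_add_single_linearFormSum_pow (Ne.symm hea),
    hme, hma, mul_pow] at hE2
  have hγ : constantCoeff T * (d + 1 : K) * κ ^ d * ℓ e ^ d * γ = 0 := by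
    linear_combination ((d + 1 : K) * ℓ e ^ d * ℓ a) * hE1 - hE2
  have hd1 : (d + 1 : K) ≠ 0 := by exact_mod_cast hdK
  have hγ0 : γ = 0 :=
    (mul_eq_zero.mp hγ).resolve_left
      (mul_ne_zero (mul_ne_zero (mul_ne_zero hT hd1) (pow_ne_zero _ hκ)) (pow_ne_zero _ he))
  refine ⟨hγ0, hκ, ?_⟩
  simp only [MvPolynomial.eval_zero]
  exact hE1.symm

/-! ## 2. The level-2 minor -/

/-- **THE LEVEL-2 MINOR** (K25a §2; idea-4's `m_μ`): if modulo the new letter `x_λ` the cofactor is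
`S′ ≡ U·(Σ σ_i x_i)` and the contact polynomial is `h′ ≡ κ·(Σ ℓ_i x_i)` with `κ ≠ 0`, the free letter `f`
carries the form (`ℓ_f ≠ 0`), and the `(μ, f)`-minor vanishes (`σ_μ ℓ_f = σ_f ℓ_μ`), then `S′ ∈ (x_λ, x_ν, h′)`:
modulo `(x_λ, x_ν)` both are multiples of `ℓ_μ x_μ + ℓ_f x_f`. [OURS] [folklore] -/
theorem mem_span_triple_of_minor_eq_zero {lam mu nu f : Fin 4} (hlm : lam ≠ mu) (hln : lam ≠ nu) (hlf : lam ≠ f)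
    (hmn : mu ≠ nu) (hmf : mu ≠ f) (hnf : nu ≠ f) {S' U h' : MvPolynomial (Fin 4) K} {σ ℓ : Fin 4 → K} {κ : K}
    (hS : S' - U * (∑ i, C (σ i) * X i) ∈ Ideal.span {(X lam : MvPolynomial (Fin 4) K)})
    (hh : h' - C κ * (∑ i, C (ℓ i) * X i) ∈ Ideal.span {(X lam : MvPolynomial (Fin 4) K)}) (hκ : κ ≠ 0)
    (hf : ℓ f ≠ 0) (hminor : σ mu * ℓ f = σ f * ℓ mu) :
    S' ∈ Ideal.span {(X lam : MvPolynomial (Fin 4) K), X nu, h'} := by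
  obtain ⟨R, hR⟩ := Ideal.mem_span_singleton'.mp hS
  obtain ⟨R', hR'⟩ := Ideal.mem_span_singleton'.mp hh
  rw [sum_univ_of_four hlm hln hlf hmn hmf hnf] at hR hR'
  set t : K := σ f / ℓ f with ht
  have hσf : σ f = t * ℓ f := by rw [ht, div_mul_cancel₀ _ hf]
  have hσm : σ mu = t * ℓ mu := by
    refine mul_right_cancel₀ hf ?_
    rw [hminor, hσf]
    ring
  have hc1 : (C (σ mu) : MvPolynomial (Fin 4) K) = C t * C (ℓ mu) := by rw [hσm, C_mul]
  have hc2 : (C (σ f) : MvPolynomial (Fin 4) K) = C t * C (ℓ f) := by rw [hσf, C_mul]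
  have hc3 : (C κ⁻¹ * C κ : MvPolynomial (Fin 4) K) = 1 := by rw [← C_mul, inv_mul_cancel₀ hκ, C_1]
  have key : S' = (R + U * C (σ lam) - U * C t * C κ⁻¹ * R' - U * C t * C (ℓ lam)) * X lam +
      (U * C (σ nu) - U * C t * C (ℓ nu)) * X nu + (U * C t * C κ⁻¹) * h' := by
    linear_combination (-1 : MvPolynomial (Fin 4) K) * hR + (U * C t * C κ⁻¹) * hR' + (U * X mu) * hc1 +
      (U * X f) * hc2 -
      (U * C t * (C (ℓ lam) * X lam + C (ℓ mu) * X mu + C (ℓ nu) * X nu + C (ℓ f) * X f)) * hc3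
  rw [key]
  exact Ideal.add_mem _ (Ideal.add_mem _ (Ideal.mul_mem_left _ _ (Ideal.subset_span (by simp)))
    (Ideal.mul_mem_left _ _ (Ideal.subset_span (by simp)))) (Ideal.mul_mem_left _ _ (Ideal.subset_span (by simp)))

/-- The linear form `Σ σ_i x_i` vanishes at the origin. [folklore] -/
theorem one_le_ordZero_linearFormSum (σ : Fin 4 → K) :
    ((1 : ℕ) : ℕ∞) ≤ ordZero (∑ i, C (σ i) * X i : MvPolynomial (Fin 4) K) := by
  rw [Nat.cast_one, one_le_ordZero_iff]
  simp [map_sum, constantCoeff_X]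

/-- **Linear coefficients of the transported cofactor off the new letter**: if `S′ ≡ U·(Σ σ_i x_i)` modulo `x_λ`
then `coeff_{x_i} S′ = U(0)·σ_i` for `i ≠ λ`. [folklore] -/
theorem coeff_single_of_sub_mul_linearFormSum_mem_span_X {lam i : Fin 4} (hi : i ≠ lam)
    {S' U : MvPolynomial (Fin 4) K} {σ : Fin 4 → K}
    (hS : S' - U * (∑ k, C (σ k) * X k) ∈ Ideal.span {(X lam : MvPolynomial (Fin 4) K)}) :
    coeff (Finsupp.single i 1) S' = MvPolynomial.eval (0 : Fin 4 → K) U * σ i := by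
  classical
  obtain ⟨R, hR⟩ := Ideal.mem_span_singleton'.mp hS
  have hS' : S' = U * (∑ k, C (σ k) * X k) + R * X lam := by rw [hR]; ring
  have h0U : ((0 : ℕ) : ℕ∞) ≤ ordZero U := by simp
  have h1 := homogeneousComponent_mul_of_le_ordZero h0U (one_le_ordZero_linearFormSum σ)
  rw [zero_add, homogeneousComponent_zero, homogeneousComponent_eq_self (isHomogeneous_linearForm σ)] at h1
  have h2 : coeff (Finsupp.single i 1) (U * ∑ k, C (σ k) * X k) = coeff 0 U * σ i := by
    have h3 := congrArg (coeff (Finsupp.single i 1)) h1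
    rw [coeff_homogeneousComponent, Finsupp.degree_single, if_pos rfl, coeff_C_mul, coeff_single_linearForm] at h3
    exact h3
  rw [hS', coeff_add, h2, coeff_mul_X', if_neg, add_zero, MvPolynomial.eval_zero, constantCoeff_eq]
  rw [Finsupp.mem_support_iff, Finsupp.single_eq_of_ne hi.symm]
  exact fun h => h rfl

/-- **The linear part of the transported contact polynomial**: if `h′ ≡ κ·(Σ ℓ_i x_i)` modulo `x_λ` and the new
vertex form is `ℓ′ = c·ℓ` off `x_λ` (`c ≠ 0`), then `lin h′ = (κ/c)·(Σ ℓ′_i x_i) + γ·x_λ` for some `γ` — exact up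
to the new letter, which `lin_exact_of_triple_ledger` then removes. [folklore] -/
theorem exists_homogeneousComponent_one_eq_of_sub_mem_span_X {lam : Fin 4} {h' : MvPolynomial (Fin 4) K}
    {κ c : K} {ℓ ℓ' : Fin 4 → K}
    (hh : h' - C κ * (∑ i, C (ℓ i) * X i) ∈ Ideal.span {(X lam : MvPolynomial (Fin 4) K)}) (hc : c ≠ 0)
    (hprop : ∀ i, i ≠ lam → ℓ' i = c * ℓ i) :
    ∃ γ : K, homogeneousComponent 1 h' = C (κ * c⁻¹) * (∑ i, C (ℓ' i) * X i) + C γ * X lam := by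
  classical
  obtain ⟨R, hR⟩ := Ideal.mem_span_singleton'.mp hh
  have hh' : h' = C κ * (∑ i, C (ℓ i) * X i) + R * X lam := by rw [hR]; ring
  have h0R : ((0 : ℕ) : ℕ∞) ≤ ordZero R := by simp
  have h1X : ((1 : ℕ) : ℕ∞) ≤ ordZero (X lam : MvPolynomial (Fin 4) K) := by rw [ordZero_X, Nat.cast_one]
  have hRX := homogeneousComponent_mul_of_le_ordZero h0R h1X
  rw [zero_add, homogeneousComponent_zero, homogeneousComponent_eq_self (isHomogeneous_X K lam)] at hRX
  refine ⟨coeff 0 R + (κ * ℓ lam - κ * c⁻¹ * ℓ' lam), ?_⟩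
  rw [hh', map_add, hRX, homogeneousComponent_C_mul, homogeneousComponent_eq_self (isHomogeneous_linearForm ℓ)]
  -- `κ·L = (κ/c)·L′ + (κ ℓ_λ − (κ/c) ℓ′_λ)·x_λ`
  have hkey : C κ * (∑ i, C (ℓ i) * X i : MvPolynomial (Fin 4) K) - C (κ * c⁻¹) * (∑ i, C (ℓ' i) * X i) =
      C (κ * ℓ lam - κ * c⁻¹ * ℓ' lam) * X lam := by
    rw [Finset.mul_sum, Finset.mul_sum, ← Finset.sum_sub_distrib, Finset.sum_eq_single lam]
    · rw [← mul_assoc, ← mul_assoc, ← sub_mul, ← C_mul, ← C_mul, ← C_sub]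
    · intro i _ hi
      rw [hprop i hi, ← mul_assoc, ← mul_assoc, ← sub_mul, ← C_mul, ← C_mul, ← C_sub,
        show κ * ℓ i - κ * c⁻¹ * (c * ℓ i) = 0 by rw [mul_assoc, inv_mul_cancel_left₀ hc, sub_self], C_0, zero_mul]
    · intro h; exact absurd (Finset.mem_univ lam) h
  rw [C_add, add_mul, ← hkey]
  ring

/-! ## 3. The weights of three ledger letters -/

/-- **A triple ledger contains the pair ledger**, so isolation bounds the pair weight: `u·G = S·(x_a x_b x_c) + T·h^d`
(`u(0) ≠ 0`, `h ∈ 𝔪₀`, `d ≥ 2`, `a ≠ b`) and `x^r·G` isolated `q`-fold ⇒ `r_a + r_b + 3 ≤ q`. [OURS]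
[cite: EGAIV4, Thm. 16.11.2 (16.11.2.2)] -/
theorem pair_add_three_le_of_triple_ledger {q d : ℕ} {a b c : Fin 4} (hab : a ≠ b)
    {G h u S T : MvPolynomial (Fin 4) K} (hh : h ∈ originIdeal K) (hu : MvPolynomial.eval (0 : Fin 4 → K) u ≠ 0)
    (hG : u * G = S * (X a * X b * X c) + T * h ^ d) (hd : 2 ≤ d) (r : Fin 4 →₀ ℕ)
    (hiso : IsIsolated q (monomial r (1 : K) * G)) : r a + r b + 3 ≤ q := by
  by_contra hlt
  refine IsolatedBand.not_isIsolated_monomial_mul_of_unit_mul_mem hab hh hu ?_ hd r (by omega) hiso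
  exact Ideal.mem_span_pair.mpr ⟨S * X c, T, by rw [hG]; ring⟩

/-- **THREE LEDGER LETTERS WEIGH THE SAME** (K25a §3): a triple ledger on pairwise distinct `a, b, c` at an
isolated state gives `r_X + r_Y + 3 ≤ q` for the three pairs; with the light bounds `q ≤ r_X + r_Y + 3` the three
weights are equal and `q = 2·r_a + 3`. [OURS] [cite: EGAIV4, Thm. 16.11.2 (16.11.2.2)] -/
theorem r_eq_of_triple_ledger {q d : ℕ} {a b c : Fin 4} (hab : a ≠ b) (hac : a ≠ c) (hbc : b ≠ c)
    {G h u S T : MvPolynomial (Fin 4) K} (hh : h ∈ originIdeal K) (hu : MvPolynomial.eval (0 : Fin 4 → K) u ≠ 0)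
    (hG : u * G = S * (X a * X b * X c) + T * h ^ d) (hd : 2 ≤ d) (r : Fin 4 →₀ ℕ)
    (hiso : IsIsolated q (monomial r (1 : K) * G)) (hqab : q ≤ r a + r b + 3) (hqac : q ≤ r a + r c + 3)
    (hqbc : q ≤ r b + r c + 3) : r b = r a ∧ r c = r a ∧ q = 2 * r a + 3 := by
  have h1 := pair_add_three_le_of_triple_ledger hab hh hu hG hd r hiso
  have h2 := pair_add_three_le_of_triple_ledger hac hh hu
    (show u * G = S * (X a * X c * X b) + T * h ^ d by rw [hG]; ring) hd r hiso
  have h3 := pair_add_three_le_of_triple_ledger hbc hh hu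
    (show u * G = S * (X b * X c * X a) + T * h ^ d by rw [hG]; ring) hd r hiso
  omega

/-! ## 4. The move list -/

/-- **THE MOVE LIST** (K25a §4): with weights `(w, w, w, 0)` (`w ≥ 1`) on the pairwise distinct letters
`(λ, B, C, f)` and a step at the chart `j′` (`b′_{j′} = 0`) whose new boundary — the new letter of weight `w`
plus the kept old letters — weighs at least `2w + 1`: a chart `j′ ≠ f` keeps all of `λ, B, C`, and the free chart
`j′ = f` translates at most one of them. [OURS] [cite: HauserPerlega2019PRIMS, §2 (transform D' of D)] -/
theorem kept_of_count [DecidableEq K] {lam B C f j' : Fin 4} (hlB : lam ≠ B) (hlC : lam ≠ C) (hlf : lam ≠ f) (hBC : B ≠ C)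
    (hBf : B ≠ f) (hCf : C ≠ f) {b' : Fin 4 → K} {r' : Fin 4 →₀ ℕ} {w : ℕ} (hw : 1 ≤ w) (hrl : r' lam = w)
    (hrB : r' B = w) (hrC : r' C = w) (hrf : r' f = 0) (hbj : b' j' = 0)
    (hcount : 2 * w + 1 ≤ w + ∑ i ∈ Finset.univ.erase j', (if b' i = 0 then r' i else 0)) :
    (j' ≠ f → b' lam = 0 ∧ b' B = 0 ∧ b' C = 0) ∧
      (j' = f → (b' lam = 0 ∧ b' B = 0) ∨ (b' lam = 0 ∧ b' C = 0) ∨ (b' B = 0 ∧ b' C = 0)) := by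
  classical
  have hsum : (∑ i ∈ Finset.univ.erase j', (if b' i = 0 then r' i else 0)) + (if b' j' = 0 then r' j' else 0) =
      (if b' lam = 0 then r' lam else 0) + (if b' B = 0 then r' B else 0) + (if b' C = 0 then r' C else 0) +
        (if b' f = 0 then r' f else 0) := by
    rw [Finset.sum_erase_add _ _ (Finset.mem_univ j'), sum_univ_of_four hlB hlC hlf hBC hBf hCf]
  rw [hrl, hrB, hrC, hrf, if_pos hbj, ite_self] at hsum
  have hj' : j' = lam ∨ j' = B ∨ j' = C ∨ j' = f := by
    have h := Finset.mem_univ j'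
    rw [univ_eq_of_four hlB hlC hlf hBC hBf hCf] at h
    simpa [Finset.mem_insert, Finset.mem_singleton] using h
  have hxl : (if b' lam = 0 then w else 0) ≤ w := by split_ifs <;> omega
  have hxB : (if b' B = 0 then w else 0) ≤ w := by split_ifs <;> omega
  have hxC : (if b' C = 0 then w else 0) ≤ w := by split_ifs <;> omega
  have hkl : b' lam ≠ 0 → (if b' lam = 0 then w else 0) = 0 := fun h => if_neg h
  have hkB : b' B ≠ 0 → (if b' B = 0 then w else 0) = 0 := fun h => if_neg h
  have hkC : b' C ≠ 0 → (if b' C = 0 then w else 0) = 0 := fun h => if_neg h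
  rcases hj' with rfl | rfl | rfl | rfl
  · rw [hrl] at hsum
    refine ⟨fun _ => ⟨hbj, ?_, ?_⟩, fun h => absurd h hlf⟩
    · by_contra h; have := hkB h; omega
    · by_contra h; have := hkC h; omega
  · rw [hrB] at hsum
    refine ⟨fun _ => ⟨?_, hbj, ?_⟩, fun h => absurd h hBf⟩
    · by_contra h; have := hkl h; omega
    · by_contra h; have := hkC h; omega
  · rw [hrC] at hsum
    refine ⟨fun _ => ⟨?_, ?_, hbj⟩, fun h => absurd h hCf⟩
    · by_contra h; have := hkl h; omega
    · by_contra h; have := hkB h; omega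
  · rw [hrf, add_zero] at hsum
    refine ⟨fun h => absurd rfl h, fun _ => ?_⟩
    by_cases h1 : b' lam = 0
    · by_cases h2 : b' B = 0
      · exact Or.inl ⟨h1, h2⟩
      · by_cases h3 : b' C = 0
        · exact Or.inr (Or.inl ⟨h1, h3⟩)
        · exfalso; have := hkB h2; have := hkC h3; omega
    · by_cases h2 : b' B = 0
      · by_cases h3 : b' C = 0
        · exact Or.inr (Or.inr ⟨h2, h3⟩)
        · exfalso; have := hkl h1; have := hkC h3; omega
      · exfalso; have := hkl h1; have := hkB h2; omega

end ResCone

end Summit.ResolutionOfSingularities.ResolutionOfSingularities.Theorems.PIDim4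

end
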